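import Summits.CriticalPhenomena.PercolationContinuityZ3.Theorems.PercNearOneGluingNoHeavyLowerTailSahiLatinReflection
import Summits.CriticalPhenomena.PercolationContinuityZ3.Theorems.PercNearOneGluingNoHeavyLowerTailSahiLatinDictionary
import Summits.CriticalPhenomena.PercolationContinuityZ3.Theorems.PercNearOneGluingNoHeavyLowerTailSahiGridPatternYProfile

/-!
# `NoHeavyLowerTail` (crux stmt-CriticalPhenomena-4575), Sahi programme (prim-master-conj gen 46): BRIDGE — the Sahi cell's C-slot profile
# `P_y(A,B)` (`SahiGridPattern.yProfile`) IS the charge `Φ_{AB}(y)` of the Latin kernel, hence **NON-DECREASING in `y` on `A ∩ B`** (every `d`)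

Support file (`--supports stmt-CriticalPhenomena-4575`; a dictionary entry between the two vocabularies of the pattern functional on `[3]^d`:
`…SahiGridPattern{,YProfile}` (seat prim-sahi-p1 / prim-ineq-gen-4) and `…SahiLatin{Kernel,ChargeMonotone,Reflection}` (this lineage); memo
`run/shared/lean/prim/prim-l12/FROM-prim-master-conj-g46-CHARGE-MONOTONICITY.md` §1).

* `yProfile_eq_Phi`: `yProfile A B y = Phi A B y` — both are the coefficient of `[y ∈ C]` in `sStarD A B C = kappa A B C`
  (`sStarD_eq_sum_yProfile`, `kappa_eq_sStarD`, `kappa_eq_sum_Phi` after a slot swap, evaluated at `C = {y}`).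
* **`yProfile_mono_of_mem_inter`**: for up-sets `A, B ⊆ [3]^d` and `y ≤ y'` with `y ∈ A ∩ B`, `P_y(A,B) ≤ P_{y'}(A,B)` — the C-slot profile is
  order-preserving on the meet (it is `≥ 0` there and `≤ 0` off it: `yProfile_nonneg_of_mem`, `yProfile_nonpos_of_not_mem`), by
  `SahiLatin.Phi_mono_of_mem_inter`.
Everything PROVED, standard axioms; nothing is asserted about `PatternPos d` / Sahi's `C₃` / Kahn's conjecture. [this work]
-/

namespace Summit.CriticalPhenomena.PercolationContinuityZ3.Theorems.SahiLatin

open Finset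

/-- **The C-slot profile is the charge**: `yProfile A B y = Φ_{AB}(y)` on `[3]^d`. [this work] -/
theorem yProfile_eq_Phi {d : ℕ} (A B : Finset (Pt (Fin d))) (y : Pt (Fin d)) :
    SahiGridPattern.yProfile A B y = Phi A B y := by
  have h1 : SahiGridPattern.sStarD A B {y} = SahiGridPattern.yProfile A B y := by
    rw [SahiGridPattern.sStarD_eq_sum_yProfile, sum_singleton]
  have h2 : kappa A B {y} = Phi A B y := by
    rw [kappa_swap13, kappa_eq_sum_Phi, sum_singleton, Phi_comm]
  rw [← h1, ← kappa_eq_sStarD, h2]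

/-- **The C-slot profile is non-decreasing on the meet** (every `d`): for up-sets `A, B ⊆ [3]^d`, `y ≤ y'` and `y ∈ A ∩ B`,
`yProfile A B y ≤ yProfile A B y'`. [this work] -/
theorem yProfile_mono_of_mem_inter {d : ℕ} {A B : Finset (Pt (Fin d))} (hA : IsUpperSet (A : Set (Pt (Fin d))))
    (hB : IsUpperSet (B : Set (Pt (Fin d)))) {y y' : Pt (Fin d)} (hyy : y ≤ y') (hy : y ∈ A ∩ B) :
    SahiGridPattern.yProfile A B y ≤ SahiGridPattern.yProfile A B y' := by
  rw [yProfile_eq_Phi, yProfile_eq_Phi]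
  exact Phi_mono_of_mem_inter hA hB hyy (mem_inter.1 hy).1 (mem_inter.1 hy).2

end Summit.CriticalPhenomena.PercolationContinuityZ3.Theorems.SahiLatin
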